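import Summits.ResolutionOfSingularities.ResolutionOfSingularities.Theorems.FrobeniusClosingPatchingRelPerfectDepthLegalOracle
import Summits.ResolutionOfSingularities.ResolutionOfSingularities.Theorems.FrobeniusClosingPatchingRelPerfectDepthLegalPieceTransport
import HarnessLib

/-!
# Crux `PatchingRelPerfect` (stmt-ResolutionOfSingularities-16161), chain W5.2 — T6-E1b residual `LegalScopedDivisorReduction₃`,
# PHASE 2 closer (2b), D7 step 4: THE ORACLE WITH THE WAITING COMPONENTS IN THE INERT FACTOR (`Inv₄`)

[OURS · L1 W5.2 · res-D-pv-052 g6 for the (2b) D7 closer, BY NAME from res-L1-w52-lead-1's `ORACLE-HANDOFF.md` (873ae9ed5877222f) §O4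
and `PHASE2-STEPB-SPEC.md` D1/D4] Replaces the role of NO printed item; NOT a statement of the manuscript under review; fact-free.

The curve-move loop `DepthLegal.curve_loop` (…DepthLegalLoop) is generic in the invariant `Inv` carried by its oracle, and returns the inert
factor `N′` of the final state only existentially.  To process the host COMPONENT BY COMPONENT the loop is therefore run with the richer
invariant `Inv₄ k` = `Inv₃` of the active component (…DepthLegalOracle) AND the bookkeeping of the inert factor: `N = ∏ (todo ++ done)`,
`k` components still waiting — each regular, effective Cartier, reduced with irreducible support, off the active host, and carrying its own
`Inv₃` — and the components already separated from the positive boundary.  This file supplies the oracle for `Inv₄ k`: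

* `WaitingPiece`, `DonePiece`, `Inv₄` — the clauses (Prop-valued structures, OURS bookkeeping only);
* `comap_list_prod` — `(∏ Gs)𝒪 = ∏ (G𝒪)`;
* `WaitingPiece.step`, `DonePiece.step` — one curve move inside the active host transports the clauses
  (…DepthLegalPieceTransport + the tree's `BlowupDisjointCentreWeights` toolkit);
* **`curveOracle₄ k : CurveOracle (Inv₄ k)`** — the curve of `curveOracle₃`, with `Inv₄ k` re-established after the move.

AI-written; AI review is weaker than expert review.

## References
* J. Kollár, *Lectures on Resolution of Singularities* (2007), 3.104 Step 2.1, (3.111) Step 3. [Kollar2007]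
* E. Bierstone, D. Grigoriev, P. Milman, J. Włodarczyk, arXiv:1206.3090, Lemma 3.7.1, §4 Step 2. [BierstoneGrigorievMilmanWlodarczyk2011]
* The Stacks Project, Tags 02OS, 0357. [StacksProject]
-/

-- `Summit.<Summit>.<Sub>.Theorems` with `Sub = Summit` (single-conjunct summit, D-0017)
set_option linter.dupNamespace false

noncomputable section

open CategoryTheory CategoryTheory.Limits AlgebraicGeometry TopologicalSpace IsLocalRing
open Literature.AlgebraicGeometry.Resolution Scheme.IdealSheafData

namespace Summit.ResolutionOfSingularities.ResolutionOfSingularities.Theorems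

universe u

namespace DepthLegal

open WeightTwoB DepthTargets

/-! ## §1 The clauses -/

variable {E : Scheme.{u}}

/-- [OURS · L1 W5.2] **A host component WAITING for the separation game** (relative to the active host `D` and the boundary list `L`):
off `V(D)`, regular, effective Cartier, reduced with irreducible support, and carrying the oracle's entry invariant `Inv₃` — its trace of
the boundary monomial lies in a strict normal crossings divisor of `V(G)`. NOT a statement of the manuscript.
[cite: StacksProject, Tag 0357] -/
structure WaitingPiece (D : E.IdealSheafData) (L : List (E.IdealSheafData × ℕ)) (G : E.IdealSheafData) : Prop where
  /-- off the active host -/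
  disj : Disjoint (G.support : Set E) D.support
  /-- `V(G)` is regular -/
  reg : Scheme.IsRegular G.subscheme
  /-- `G` is an effective Cartier divisor -/
  cartier : IsEffectiveCartier G
  /-- `Supp G` is irreducible -/
  irred : IsIrreducible (G.support : Set E)
  /-- `G` is reduced -/
  rad : G = vanishingIdeal G.support
  /-- the oracle's entry invariant `Inv₃` on `V(G)` -/
  inv₃ : ∃ BX : Set G.subscheme, IsStrictNormalCrossingsDivisor G.subscheme BX ∧
    (((monomialIdeal L).comap G.subschemeι).support : Set G.subscheme) ⊆ BX

/-- [OURS · L1 W5.2] **A host component DONE with the separation game**: off `V(D)`, regular, effective Cartier, and disjoint from every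
positive-exponent boundary member. NOT a statement of the manuscript. [cite: BierstoneGrigorievMilmanWlodarczyk2011, Def. 3.1.1] -/
structure DonePiece (D : E.IdealSheafData) (L : List (E.IdealSheafData × ℕ)) (G : E.IdealSheafData) : Prop where
  /-- off the active host -/
  disj : Disjoint (G.support : Set E) D.support
  /-- `V(G)` is regular -/
  reg : Scheme.IsRegular G.subscheme
  /-- `G` is an effective Cartier divisor -/
  cartier : IsEffectiveCartier G
  /-- off every positive-exponent boundary member -/
  sep : ∀ p ∈ L, 0 < p.2 → Disjoint (G.support : Set E) p.1.support

/-- [OURS · L1 W5.2] **The invariant `Inv₄ k` of the component-by-component STEP B loop**: `Inv₃` of the active host (its trace in a strict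
normal crossings divisor; `dim E ≤ 3`) and the inert factor `N = ∏ (todo ++ done)` with `k` waiting and some done components, pairwise
disjoint. NOT a statement of the manuscript. [cite: Kollar2007, (3.111) Step 3] -/
structure Inv₄ (k : ℕ) {E : Scheme.{u}} (H N D : E.IdealSheafData) (L : List (E.IdealSheafData × ℕ)) : Prop where
  /-- `Inv₃` of the active host: its trace lies in a strict normal crossings divisor -/
  inv₃ : ∃ BX : Set D.subscheme, IsStrictNormalCrossingsDivisor D.subscheme BX ∧
      (((monomialIdeal L).comap D.subschemeι).support : Set D.subscheme) ⊆ BX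
  /-- the dimension bound -/
  dim : topologicalKrullDim E ≤ 3
  /-- the inert factor: `k` waiting and some done components, pairwise disjoint -/
  pieces : ∃ todo done : List E.IdealSheafData, todo.length = k ∧ N = (todo ++ done).prod ∧
      (todo ++ done).Pairwise (fun G G' => Disjoint (G.support : Set E) G'.support) ∧
      (∀ G ∈ todo, WaitingPiece D L G) ∧ (∀ G ∈ done, DonePiece D L G)

/-- `(∏ Gs)𝒪 = ∏ (G𝒪)`: pull-back is multiplicative on lists of ideal sheaves. [folklore] -/
theorem comap_list_prod {E' : Scheme.{u}} (f : E' ⟶ E) (Gs : List E.IdealSheafData) :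
    (Gs.prod).comap f = (Gs.map fun G => G.comap f).prod := by
  induction Gs with
  | nil => simp [Scheme.IdealSheafData.one_eq_top, Scheme.IdealSheafData.comap_top]
  | cons G Gs ih => rw [List.prod_cons, List.map_cons, List.prod_cons, comap_mul, ih]

/-- The support of a list product is the union of the supports; so it is disjoint from a set iff every factor is. [folklore] -/
theorem disjoint_support_list_prod_iff (Gs : List E.IdealSheafData) (S : Set E) :
    Disjoint ((Gs.prod).support : Set E) S ↔ ∀ G ∈ Gs, Disjoint (G.support : Set E) S := by
  rw [IdealSheafData.coe_support_prod, Set.disjoint_iUnion₂_left]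

/-! ## §2 One curve move inside the active host transports the clauses -/

section Step

variable [IsLocallyNoetherian E] {E' : Scheme.{u}} {τ : E' ⟶ E} {Z : Closeds E} {η : E}
  {D G : E.IdealSheafData} {L : List (E.IdealSheafData × ℕ)}

/-- **A waiting component rides along a move** `τ` of centre `Z ⊆ V(D)`, normal crossings with the boundary, weight `w = weightAt L η ≥ 1`:
`WaitingPiece (τᶜ(D,1)) L′ (G𝒪)` for the pruned new list `L′`. [cite: StacksProject, Tag 02OS] [cite: BierstoneGrigorievMilmanWlodarczyk2011, §4 Step 2] -/
theorem WaitingPiece.step (hG : WaitingPiece D L G) (hη : IsGenericPoint η (Z : Set E))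
    (hnc : HasSNCWith (boundaryOf L) (vanishingIdeal Z)) (hτ : IsBlowup τ (vanishingIdeal Z)) (hw : 1 ≤ weightAt L η)
    (hZD : (Z : Set E) ⊆ D.support) :
    WaitingPiece (controlledTransform τ (vanishingIdeal Z) D 1)
      ((stepExp L τ (vanishingIdeal Z) (weightAt L η - 1)).filter fun p => decide (0 < p.2)) (G.comap τ) := by
  obtain ⟨hGD, hreg, hcart, hirr, hrad, hInv⟩ := hG
  have hd : Disjoint ((vanishingIdeal Z).support : Set E) (G.support : Set E) := by
    rw [Scheme.IdealSheafData.coe_support_vanishingIdeal]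
    exact Set.disjoint_of_subset_left hZD hGD.symm
  refine ⟨disjoint_support_comap_controlledTransform hGD _, hτ.isRegular_subscheme_comap_of_disjoint hd hreg,
    hcart.comap_of_isBlowup hτ, hτ.isIrreducible_support_comap_of_disjoint hd hirr, hτ.comap_eq_vanishingIdeal_of_disjoint hd hrad, ?_⟩
  rw [DepthSNC.monomialIdeal_filter_pos]
  exact exists_sncd_trace_comap_of_disjoint hη hnc hτ hw hZD hGD hInv

omit [IsLocallyNoetherian E] in
/-- **A done component rides along a move.** [cite: BierstoneGrigorievMilmanWlodarczyk2011, §4 Step 2] -/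
theorem DonePiece.step [IsLocallyNoetherian E] (hG : DonePiece D L G) (hτ : IsBlowup τ (vanishingIdeal Z)) (hZD : (Z : Set E) ⊆ D.support)
    (e : ℕ) :
    DonePiece (controlledTransform τ (vanishingIdeal Z) D 1)
      ((stepExp L τ (vanishingIdeal Z) e).filter fun p => decide (0 < p.2)) (G.comap τ) := by
  obtain ⟨hGD, hreg, hcart, hdisj⟩ := hG
  have hd : Disjoint ((vanishingIdeal Z).support : Set E) (G.support : Set E) := by
    rw [Scheme.IdealSheafData.coe_support_vanishingIdeal]
    exact Set.disjoint_of_subset_left hZD hGD.symm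
  refine ⟨disjoint_support_comap_controlledTransform hGD _, hτ.isRegular_subscheme_comap_of_disjoint hd hreg,
    hcart.comap_of_isBlowup hτ, fun p hp hpos => ?_⟩
  exact disjoint_support_comap_stepExp_of_disjoint hZD hGD hdisj e p (List.mem_of_mem_filter hp) hpos

end Step

/-! ## §3 The oracle for `Inv₄ k` -/

/-- [OURS · L1 W5.2] **THE CURVE-CHOOSING ORACLE WITH THE INERT-FACTOR BOOKKEEPING**: the curve is the one of `curveOracle₃`; after the move,
`Inv₃` of the new active host comes from `curveOracle₃`, and the waiting / done components are transported by `WaitingPiece.step` /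
`DonePiece.step` (the centre lies in the active host, which every other component misses). [cite: Kollar2007, 3.104 Step 2.1, (3.111) Step 3]
[cite: StacksProject, Tag 02OS] -/
theorem curveOracle₄ (k : ℕ) : DepthLegal.CurveOracle.{u} (@Inv₄ k) := by
  intro E _ _ H N D L S hXint hpos hInv hT hT'
  obtain ⟨hInv₃, hdim, ⟨todo, done, hlen, hN, hpw, htodo, hdone⟩⟩ := hInv
  obtain ⟨ζ, hζ, hζT, hZ, hnc, hInv₃'⟩ := curveOracle₃ S hXint hpos ⟨hInv₃, hdim⟩ hT hT'
  refine ⟨ζ, hζ, hζT, hZ, hnc, hInv₃'.1, hInv₃'.2,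
    todo.map fun G => G.comap (blowup.π (vanishingIdeal (⟨closure {D.subschemeι ζ}, isClosed_closure⟩ : Closeds E))),
    done.map fun G => G.comap (blowup.π (vanishingIdeal (⟨closure {D.subschemeι ζ}, isClosed_closure⟩ : Closeds E))),
    by rw [List.length_map, hlen], ?_, ?_, ?_, ?_⟩
  · -- `N𝒪 = ∏ (G𝒪)`
    rw [hN, comap_list_prod, List.map_append]
  · -- pairwise disjointness pulls back
    rw [← List.map_append]
    exact List.Pairwise.map _ (fun G G' (h : Disjoint (G.support : Set E) G'.support) => disjoint_support_comap_of_disjoint h _) hpw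
  · -- waiting components
    intro G' hG'
    obtain ⟨G, hG, rfl⟩ := List.mem_map.mp hG'
    have hη : IsGenericPoint (D.subschemeι ζ) ((⟨closure {D.subschemeι ζ}, isClosed_closure⟩ : Closeds E) : Set E) :=
      isGenericPoint_closure
    have hZD : ((⟨closure {D.subschemeι ζ}, isClosed_closure⟩ : Closeds E) : Set E) ⊆ D.support :=
      closure_minimal (Set.singleton_subset_iff.mpr (subschemeι_apply_mem_support D ζ)) D.support.isClosed
    have hζM : D.subschemeι ζ ∈ (monomialIdeal L).support := (mem_support_comap_iff D.subschemeι (monomialIdeal L) ζ).mp hζT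
    have hZM : ((⟨closure {D.subschemeι ζ}, isClosed_closure⟩ : Closeds E) : Set E) ⊆ (monomialIdeal L).support :=
      closure_minimal (Set.singleton_subset_iff.mpr hζM) (monomialIdeal L).support.isClosed
    exact (htodo G hG).step hη hnc (blowup.isBlowup _) (S.toHostState.one_le_weightAt hη hZM) hZD
  · -- done components
    intro G' hG'
    obtain ⟨G, hG, rfl⟩ := List.mem_map.mp hG'
    have hZD : ((⟨closure {D.subschemeι ζ}, isClosed_closure⟩ : Closeds E) : Set E) ⊆ D.support :=
      closure_minimal (Set.singleton_subset_iff.mpr (subschemeι_apply_mem_support D ζ)) D.support.isClosed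
    exact (hdone G hG).step (blowup.isBlowup _) hZD _

end DepthLegal

end Summit.ResolutionOfSingularities.ResolutionOfSingularities.Theorems

end
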